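import Literature.Analysis.FluidPDE.VectorCalculus
import Mathlib.Analysis.Distribution.AEEqOfIntegralContDiff
import Mathlib.Analysis.Calculus.ParametricIntegral
import Mathlib.Analysis.InnerProductSpace.Calculus
import Mathlib.Analysis.SpecialFunctions.ExpDeriv
import Mathlib.MeasureTheory.Measure.Lebesgue.EqHaar
import HarnessLib

/-!
# A radial, weakly divergence-free, locally square-integrable vector field on `ℝ³` vanishes

Analysis/FluidPDE proof file (everything proved; no definitions, no named facts), a kinematic
lemma on the discharge path of the named fact
`Literature.Analysis.FluidPDE.seregin_sverak_2002` (`SereginSverakPressure.lean`; G. Seregin,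
V. Šverák, *Navier–Stokes equations with lower bounds on the pressure*, Arch. Ration. Mech.
Anal. 163 (2002) 65–86, main theorem). In the reconstruction of the endgame recorded in the
companion files `SereginSverakPressureTypeI.lean` (one-sided pressure bound ⇒ monotone scaled
energy, Type I, and the weighted *tangential* bound `∫ |u_τ|²/|x - x₀| dx ≤ C`) the final-time
profile of a blow-up limit at a singular point is a locally square-integrable, weakly
divergence-free field `V` on `ℝ³` whose tangential part about the blow-up centre vanishes
(the weighted tangential bound is scale invariant and a single integral is absolutely
continuous), while `ε`-regularity forces `V` to carry scale-invariant energy at the centre. The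
present file proves that the first two properties already force `V = 0`:

* `SereginSverak2002.ae_eq_zero_of_isWeaklyDivFree_of_radial` — **a radial
  (`|y|² V(y) = ⟪V(y), y⟫ y` a.e.), weakly divergence-free (`∫ ⟪V, ∇θ⟫ = 0` for all test
  functions, the tree's `IsWeaklyDivFree`), locally integrable field `V : ℝ³ → ℝ³` with
  `∫_{B₁} |V|² < ∞` vanishes a.e.**

Informally: `div (f(y) y) = y·∇f + 3f = 0` makes `f` homogeneous of degree `-3`, i.e.
`V = c(ŷ) ŷ/|y|²`, which is square integrable near the origin only if `c = 0`. The proof below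
avoids polar coordinates and pointwise homogeneity:

* `integral_inner_self_mul_euler_eq_zero` — testing `div V = 0` with `θ(y) = |y|² h(y)` and
  using radiality gives `∫ ⟪V(y), y⟫ (2h(y) + Dh(y)·y) dy = 0` for every smooth compactly
  supported `h` (the pairing `T = ⟪V, y⟫` is annihilated by the adjoint Euler operator);
* `hasDerivAt_integral_inner_self_mul_comp_exp_smul`, `integral_inner_self_mul_comp_exp_smul_eq`
  — for the dilates `h = g(e^{-s} ·)` this is the ODE `G' = 2G` for
  `G(s) = ∫ ⟪V(y), y⟫ g(e^{-s} y) dy` (differentiation under the integral sign), whence the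
  exact scaling law `G(s) = e^{2s} G(0)`;
* `integral_inner_self_mul_eq_zero` — if `g` is supported in an annulus, the dilated pairings
  `∫ ⟪V, y⟫ g(bᵏ⁺¹ y) = b^{-2(k+1)} G(0)` live on disjoint shells `S_k ⊆ B₁`, and each is at most
  `(M r₂ / bᵏ⁺¹) ∫_{S_k} |V|`; with `2t|V| ≤ t² + |V|²` this gives `∫_{S_k} |V|² ≥ β > 0` for all
  `k` unless `G(0) = 0`, contradicting `∫_{B₁} |V|² < ∞`;
* hence `⟪V(y), y⟫ = 0` a.e. off the origin (Mathlib's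
  `IsOpen.ae_eq_zero_of_integral_contDiff_smul_eq_zero`), and radiality gives `V = 0` a.e.

## Mathlib / tree search

Tree: `IsWeaklyDivFree`, `FunctionSpaces.IsTestFunctionOn` (`VectorCalculus.lean`,
`SobolevDomain.lean`); `lean search 'radial.*div\|IsWeaklyDivFree.*zero'` — nothing of this
kind. Mathlib: `hasDerivAt_integral_of_dominated_loc_of_deriv_le`,
`IsOpen.ae_eq_zero_of_integral_contDiff_smul_eq_zero`, `hasStrictFDerivAt_norm_sq`,
`is_const_of_deriv_eq_zero`, `Measure.addHaar_ball_of_pos`, `integral_biUnion_finset`,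
`two_mul_le_add_sq`.

## References

* G. Seregin, V. Šverák, Arch. Ration. Mech. Anal. 163 (2002), 65–86 (the result served).
  [SereginSverak2002]
* L. C. Evans, *Partial Differential Equations*, 2nd ed., §5.2.1 (weak derivatives, test
  functions). [Evans2010]
-/

noncomputable section

open MeasureTheory Set Function Filter Topology Metric
open scoped ContDiff NNReal ENNReal RealInnerProductSpace

namespace Literature.Analysis.FluidPDE

namespace SereginSverak2002


variable {V : (EuclideanSpace ℝ (Fin 3)) → (EuclideanSpace ℝ (Fin 3))}

/-! ### The radial pairing `y ↦ ⟪V y, y⟫` -/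

/-- The radial pairing `y ↦ ⟪V(y), y⟫` of a locally integrable field is locally integrable.
[folklore] -/
theorem locallyIntegrable_inner_self (hV : LocallyIntegrable V) :
    LocallyIntegrable (fun y : (EuclideanSpace ℝ (Fin 3)) => ⟪V y, y⟫) := by
  rw [MeasureTheory.locallyIntegrable_iff]
  intro K hK
  obtain ⟨R, hR⟩ := hK.isBounded.subset_closedBall (0 : (EuclideanSpace ℝ (Fin 3)))
  have hVK : IntegrableOn V K := hV.integrableOn_isCompact hK
  have hmeas : AEStronglyMeasurable (fun y => ⟪V y, y⟫) (volume.restrict K) :=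
    hVK.aestronglyMeasurable.inner aestronglyMeasurable_id
  refine Integrable.mono' (hVK.norm.mul_const |R|) hmeas ?_
  filter_upwards [ae_restrict_mem hK.measurableSet] with y hy
  have hyR : ‖y‖ ≤ |R| := by
    have h := hR hy
    rw [mem_closedBall, dist_zero_right] at h
    exact h.trans (le_abs_self R)
  calc ‖⟪V y, y⟫‖ ≤ ‖V y‖ * ‖y‖ := norm_inner_le_norm _ _
    _ ≤ ‖V y‖ * |R| := by gcongr

/-- The pairing `∫ ⟪V(y), y⟫ g(y) dy` against a continuous compactly supported `g` converges
absolutely. [folklore] -/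
theorem integrable_inner_self_mul (hV : LocallyIntegrable V) {g : (EuclideanSpace ℝ (Fin 3)) → ℝ}
    (hg : Continuous g) (hgc : HasCompactSupport g) :
    Integrable (fun y => ⟪V y, y⟫ * g y) := by
  have h := (locallyIntegrable_inner_self hV).integrable_smul_left_of_hasCompactSupport hg hgc
  refine h.congr (Eventually.of_forall fun y => ?_)
  simp [smul_eq_mul, mul_comm]

/-- A dilate `y ↦ g(c y)`, `c ≠ 0`, of a smooth compactly supported function is smooth and
compactly supported. [folklore] -/
theorem contDiff_comp_smul {g : (EuclideanSpace ℝ (Fin 3)) → ℝ} (hg : ContDiff ℝ ∞ g) (c : ℝ) :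
    ContDiff ℝ ∞ (fun y : (EuclideanSpace ℝ (Fin 3)) => g (c • y)) :=
  hg.comp (contDiff_const_smul c)

/-- The derivative of the dilate: `D(g(c ·))(y) v = Dg(c y)(c v)`. [folklore] -/
theorem fderiv_comp_smul_apply {g : (EuclideanSpace ℝ (Fin 3)) → ℝ} (hg : ContDiff ℝ ∞ g) (c : ℝ)
    (y v : (EuclideanSpace ℝ (Fin 3))) :
    fderiv ℝ (fun y : (EuclideanSpace ℝ (Fin 3)) => g (c • y)) y v =
      fderiv ℝ g (c • y) (c • v) := by
  have hg1 : ContDiff ℝ 1 g := hg.of_le (by exact_mod_cast le_top)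
  have hd : HasFDerivAt g (fderiv ℝ g (c • y)) (c • y) :=
    ((hg1.differentiable one_ne_zero) (c • y)).hasFDerivAt
  have hL : HasFDerivAt (fun y : (EuclideanSpace ℝ (Fin 3)) => c • y)
      (c • ContinuousLinearMap.id ℝ (EuclideanSpace ℝ (Fin 3))) y :=
    (hasFDerivAt_id y).const_smul c
  have hcomp := hd.comp y hL
  rw [show (fun y : (EuclideanSpace ℝ (Fin 3)) => g (c • y)) =
      g ∘ fun y : (EuclideanSpace ℝ (Fin 3)) => c • y from rfl, hcomp.fderiv]
  simp

/-! ### Step 1: testing `div V = 0` with `|y|² h(y)` -/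

/-- **The radial pairing is annihilated by the adjoint Euler operator.** For a locally
integrable, weakly divergence-free field `V` which is radial a.e. (`|y|² V(y) = ⟪V(y), y⟫ y`),
and every smooth compactly supported `h`,
`∫ ⟪V(y), y⟫ (2 h(y) + Dh(y)·y) dy = 0`.
Proof: `θ(y) = |y|² h(y)` is a test function with `∇θ = 2h y + |y|² ∇h`, and by radiality
`⟪V, ∇θ⟫ = ⟪V, y⟫ (2h + y·∇h)` a.e. [folklore] -/
theorem integral_inner_self_mul_euler_eq_zero (hdiv : IsWeaklyDivFree V)
    (hrad : ∀ᵐ y ∂(volume : Measure (EuclideanSpace ℝ (Fin 3))), (‖y‖ ^ 2) • V y = ⟪V y, y⟫ • y)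
    {h : (EuclideanSpace ℝ (Fin 3)) → ℝ} (hh : ContDiff ℝ ∞ h) (hhc : HasCompactSupport h) :
    ∫ y, ⟪V y, y⟫ * (2 * h y + fderiv ℝ h y y) = 0 := by
  have hφt : FunctionSpaces.IsTestFunctionOn (⊤ : TopologicalSpace.Opens (EuclideanSpace ℝ (Fin 3)))
      (fun y : (EuclideanSpace ℝ (Fin 3)) => ‖y‖ ^ 2 * h y) :=
    ⟨(contDiff_norm_sq ℝ).mul hh, hhc.mul_left, by simp⟩
  have h0 := hdiv _ hφt
  rw [← h0]
  refine integral_congr_ae ?_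
  filter_upwards [hrad] with y hy
  have hh1 : ContDiff ℝ 1 h := hh.of_le (by exact_mod_cast le_top)
  have h1 : HasFDerivAt (fun y : (EuclideanSpace ℝ (Fin 3)) => ‖y‖ ^ 2) (2 • innerSL ℝ y) y :=
    (hasStrictFDerivAt_norm_sq y).hasFDerivAt
  have h2 : HasFDerivAt h (fderiv ℝ h y) y := ((hh1.differentiable one_ne_zero) y).hasFDerivAt
  have hd : HasFDerivAt (fun y : (EuclideanSpace ℝ (Fin 3)) => ‖y‖ ^ 2 * h y)
      (‖y‖ ^ 2 • fderiv ℝ h y + h y • (2 • innerSL ℝ y)) y := h1.mul h2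
  rw [gradient]
  conv_rhs => rw [real_inner_comm, InnerProductSpace.toDual_symm_apply]
  rw [hd.fderiv]
  simp only [add_apply, smul_apply, innerSL_apply_apply,
    smul_eq_mul, nsmul_eq_mul, Nat.cast_ofNat]
  have key : ‖y‖ ^ 2 * fderiv ℝ h y (V y) = ⟪V y, y⟫ * fderiv ℝ h y y := by
    rw [← smul_eq_mul, ← ContinuousLinearMap.map_smul, hy, ContinuousLinearMap.map_smul,
      smul_eq_mul]
  rw [key, real_inner_comm y]
  ring

/-! ### Step 2: the dilation family and its scaling law -/

/-- **Differentiation under the integral sign** for the dilation family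
`G(s) = ∫ ⟪V(y), y⟫ g(e^{-s} y) dy` of a smooth compactly supported `g`:
`G'(s₀) = -∫ ⟪V(y), y⟫ Dg(e^{-s₀} y)(e^{-s₀} y) dy`. [folklore] -/
theorem hasDerivAt_integral_inner_self_mul_comp_exp_smul (hV : LocallyIntegrable V)
    {g : (EuclideanSpace ℝ (Fin 3)) → ℝ} (hg : ContDiff ℝ ∞ g) (hgc : HasCompactSupport g)
    (s₀ : ℝ) :
    HasDerivAt (fun s => ∫ y, ⟪V y, y⟫ * g (Real.exp (-s) • y))
      (∫ y, ⟪V y, y⟫ * -(fderiv ℝ g (Real.exp (-s₀) • y) (Real.exp (-s₀) • y))) s₀ := by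
  have hg1 : ContDiff ℝ 1 g := hg.of_le (by exact_mod_cast le_top)
  have hgd : Differentiable ℝ g := hg1.differentiable one_ne_zero
  have hgc' : Continuous g := hg.continuous
  have hDgc : Continuous (fderiv ℝ g) := hg1.continuous_fderiv one_ne_zero
  -- a radius containing the support and a bound on the derivative
  obtain ⟨R, hRpos, hR⟩ : ∃ R, 0 < R ∧ tsupport g ⊆ ball (0 : (EuclideanSpace ℝ (Fin 3))) R :=
    hgc.isCompact.isBounded.subset_ball_lt 0 0
  obtain ⟨M, hM⟩ := hDgc.bounded_above_of_compact_support (hgc.fderiv (𝕜 := ℝ))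
  have hM0 : 0 ≤ M := (norm_nonneg _).trans (hM 0)
  -- the integrands
  set F : ℝ → (EuclideanSpace ℝ (Fin 3)) → ℝ := fun s y => ⟪V y, y⟫ * g (Real.exp (-s) • y) with hF
  set F' : ℝ → (EuclideanSpace ℝ (Fin 3)) → ℝ := fun s y =>
    ⟪V y, y⟫ * -(fderiv ℝ g (Real.exp (-s) • y) (Real.exp (-s) • y)) with hF'
  -- integrability of `F s`
  have hFint : ∀ s, Integrable (F s) := fun s =>
    integrable_inner_self_mul hV (hgc'.comp (continuous_const_smul _))
      (hgc.comp_smul (Real.exp_pos _).ne')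
  -- continuity and compact support of the derivative integrand
  have hψc : ∀ s, Continuous fun y : (EuclideanSpace ℝ (Fin 3)) =>
      -(fderiv ℝ g (Real.exp (-s) • y) (Real.exp (-s) • y)) := fun s =>
    ((hDgc.comp (continuous_const_smul _)).clm_apply (continuous_const_smul _)).neg
  have hψs : ∀ s, HasCompactSupport fun y : (EuclideanSpace ℝ (Fin 3)) =>
      -(fderiv ℝ g (Real.exp (-s) • y) (Real.exp (-s) • y)) := by
    intro s
    refine ((hgc.fderiv (𝕜 := ℝ)).comp_smul (Real.exp_pos (-s)).ne').mono ?_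
    intro y hy
    simp only [mem_support, ne_eq, neg_eq_zero] at hy ⊢
    intro h0
    exact hy (by rw [h0]; simp)
  have hF'int : ∀ s, Integrable (F' s) := fun s =>
    integrable_inner_self_mul hV (hψc s) (hψs s)
  -- the dominating function on `ball s₀ 1`
  set K : Set (EuclideanSpace ℝ (Fin 3)) :=
    closedBall (0 : (EuclideanSpace ℝ (Fin 3))) (Real.exp (s₀ + 1) * R) with hK
  have hKc : IsCompact K := isCompact_closedBall _ _
  have hTK : IntegrableOn (fun y : (EuclideanSpace ℝ (Fin 3)) => ⟪V y, y⟫) K :=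
    (locallyIntegrable_inner_self hV).integrableOn_isCompact hKc
  set bound : (EuclideanSpace ℝ (Fin 3)) → ℝ := K.indicator fun y => M * R * ‖⟪V y, y⟫‖ with hbound
  have hbound_int : Integrable bound := by
    rw [hbound, integrable_indicator_iff hKc.measurableSet]
    exact (hTK.norm.const_mul (M * R))
  have key := hasDerivAt_integral_of_dominated_loc_of_deriv_le (μ := volume) (𝕜 := ℝ)
    (F := F) (F' := F') (bound := bound) (ball_mem_nhds s₀ zero_lt_one) ?_ (hFint s₀)
    (hF'int s₀).aestronglyMeasurable ?_ hbound_int ?_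
  · exact key.2
  · exact Eventually.of_forall fun s => (hFint s).aestronglyMeasurable
  · -- the bound
    refine Eventually.of_forall fun y s hs => ?_
    have hs' : s < s₀ + 1 := by
      have := mem_ball_iff_norm.1 hs
      rw [Real.norm_eq_abs, abs_lt] at this
      linarith
    simp only [hF', norm_mul, norm_neg]
    by_cases hz : Real.exp (-s) • y ∈ tsupport g
    · -- inside the (dilated) support: `‖y‖ ≤ e^{s} R ≤ e^{s₀ + 1} R`
      have hzR : ‖Real.exp (-s) • y‖ < R := by
        have := hR hz
        rwa [mem_ball, dist_zero_right] at this
      have hyK : y ∈ K := by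
        rw [hK, mem_closedBall, dist_zero_right]
        rw [norm_smul, Real.norm_eq_abs, abs_of_pos (Real.exp_pos _)] at hzR
        have hy : ‖y‖ < Real.exp s * R := by
          have h := mul_lt_mul_of_pos_left hzR (Real.exp_pos s)
          rwa [← mul_assoc, ← Real.exp_add, add_neg_cancel, Real.exp_zero, one_mul] at h
        have hss : Real.exp s * R ≤ Real.exp (s₀ + 1) * R :=
          mul_le_mul_of_nonneg_right (Real.exp_le_exp.2 hs'.le) hRpos.le
        exact (hy.le.trans hss)
      rw [hbound, indicator_of_mem hyK]
      have hD : ‖fderiv ℝ g (Real.exp (-s) • y) (Real.exp (-s) • y)‖ ≤ M * R :=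
        calc ‖fderiv ℝ g (Real.exp (-s) • y) (Real.exp (-s) • y)‖
            ≤ ‖fderiv ℝ g (Real.exp (-s) • y)‖ * ‖Real.exp (-s) • y‖ :=
              ContinuousLinearMap.le_opNorm _ _
          _ ≤ M * R := mul_le_mul (hM _) hzR.le (norm_nonneg _) hM0
      calc ‖⟪V y, y⟫‖ * ‖fderiv ℝ g (Real.exp (-s) • y) (Real.exp (-s) • y)‖
          ≤ ‖⟪V y, y⟫‖ * (M * R) := by gcongr
        _ = M * R * ‖⟪V y, y⟫‖ := by ring
    · -- outside the support the derivative vanishes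
      have hD0 : fderiv ℝ g (Real.exp (-s) • y) = 0 := by
        by_contra hne
        exact hz (support_fderiv_subset ℝ (mem_support.2 hne))
      have h00 : ‖⟪V y, y⟫‖ * ‖fderiv ℝ g (Real.exp (-s) • y) (Real.exp (-s) • y)‖ = 0 := by
        rw [hD0]; simp
      rw [h00, hbound]
      exact indicator_nonneg (fun z _ => by positivity) y
  · -- pointwise derivative in `s`
    refine Eventually.of_forall fun y s _ => ?_
    have hγ : HasDerivAt (fun s : ℝ => Real.exp (-s) • y) ((Real.exp (-s) * -1) • y) s :=
      ((Real.hasDerivAt_exp (-s)).comp s (hasDerivAt_neg s)).smul_const y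
    have hcomp : HasDerivAt (fun s : ℝ => g (Real.exp (-s) • y))
        (fderiv ℝ g (Real.exp (-s) • y) ((Real.exp (-s) * -1) • y)) s :=
      ((hgd (Real.exp (-s) • y)).hasFDerivAt).comp_hasDerivAt s hγ
    have h3 := hcomp.const_mul ⟪V y, y⟫
    simp only [hF, hF']
    refine h3.congr_deriv ?_
    rw [mul_neg_one, neg_smul, ContinuousLinearMap.map_neg]

/-- **The ODE `G' = 2G`** for the dilation family of a radial weakly divergence-free field:
combine the previous derivative with Step 1 for `h = g(e^{-s₀} ·)`, whose Euler derivative is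
`Dh(y)·y = Dg(e^{-s₀}y)(e^{-s₀}y)`. [folklore] -/
theorem hasDerivAt_integral_inner_self_mul_comp_exp_smul_two_mul (hV : LocallyIntegrable V)
    (hdiv : IsWeaklyDivFree V)
    (hrad : ∀ᵐ y ∂(volume : Measure (EuclideanSpace ℝ (Fin 3))), (‖y‖ ^ 2) • V y = ⟪V y, y⟫ • y)
    {g : (EuclideanSpace ℝ (Fin 3)) → ℝ} (hg : ContDiff ℝ ∞ g) (hgc : HasCompactSupport g)
    (s₀ : ℝ) :
    HasDerivAt (fun s => ∫ y, ⟪V y, y⟫ * g (Real.exp (-s) • y))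
      (2 * ∫ y, ⟪V y, y⟫ * g (Real.exp (-s₀) • y)) s₀ := by
  have hder := hasDerivAt_integral_inner_self_mul_comp_exp_smul hV hg hgc s₀
  set c : ℝ := Real.exp (-s₀) with hc
  have hc0 : c ≠ 0 := (Real.exp_pos _).ne'
  -- Step 1 for the dilate `h = g (c • ·)`
  have hstep := integral_inner_self_mul_euler_eq_zero hdiv hrad (contDiff_comp_smul hg c)
    (hgc.comp_smul hc0)
  have hD : ∀ y : (EuclideanSpace ℝ (Fin 3)),
      fderiv ℝ (fun y : (EuclideanSpace ℝ (Fin 3)) => g (c • y)) y y = fderiv ℝ g (c • y) (c • y) :=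
    fun y => fderiv_comp_smul_apply hg c y y
  simp_rw [hD] at hstep
  -- split the integral of Step 1
  have hI1 : Integrable fun y : (EuclideanSpace ℝ (Fin 3)) => ⟪V y, y⟫ * g (c • y) :=
    integrable_inner_self_mul hV (hg.continuous.comp (continuous_const_smul _))
      (hgc.comp_smul hc0)
  have hg1 : ContDiff ℝ 1 g := hg.of_le (by exact_mod_cast le_top)
  have hDgc : Continuous (fderiv ℝ g) := hg1.continuous_fderiv one_ne_zero
  have hψc : Continuous fun y : (EuclideanSpace ℝ (Fin 3)) => fderiv ℝ g (c • y) (c • y) :=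
    (hDgc.comp (continuous_const_smul _)).clm_apply (continuous_const_smul _)
  have hψs : HasCompactSupport fun y : (EuclideanSpace ℝ (Fin 3)) =>
      fderiv ℝ g (c • y) (c • y) := by
    refine ((hgc.fderiv (𝕜 := ℝ)).comp_smul hc0).mono ?_
    intro y hy
    simp only [mem_support, ne_eq] at hy ⊢
    intro h0
    exact hy (by rw [h0]; simp)
  have hI2 : Integrable fun y => ⟪V y, y⟫ * fderiv ℝ g (c • y) (c • y) :=
    integrable_inner_self_mul hV hψc hψs
  have hsplit : (∫ y, ⟪V y, y⟫ * (2 * g (c • y) + fderiv ℝ g (c • y) (c • y))) =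
      2 * (∫ y, ⟪V y, y⟫ * g (c • y)) + ∫ y, ⟪V y, y⟫ * fderiv ℝ g (c • y) (c • y) := by
    have h := integral_add (hI1.const_mul 2) hI2
    rw [← integral_const_mul]
    rw [← h]
    refine integral_congr_ae (Eventually.of_forall fun y => ?_)
    ring
  rw [hsplit] at hstep
  -- the derivative integral equals `2 G(s₀)`
  have hval : (∫ y, ⟪V y, y⟫ * -(fderiv ℝ g (c • y) (c • y))) =
      2 * ∫ y, ⟪V y, y⟫ * g (c • y) := by
    have hneg : (∫ y, ⟪V y, y⟫ * -(fderiv ℝ g (c • y) (c • y))) =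
        -∫ y, ⟪V y, y⟫ * fderiv ℝ g (c • y) (c • y) := by
      rw [← integral_neg]
      refine integral_congr_ae (Eventually.of_forall fun y => ?_)
      ring
    rw [hneg]
    linarith
  rw [hc] at hval
  rw [hval] at hder
  exact hder

/-- **The exact scaling law** `∫ ⟪V(y), y⟫ g(e^{-s} y) dy = e^{2s} ∫ ⟪V(y), y⟫ g(y) dy` for a
radial weakly divergence-free locally integrable field and a smooth compactly supported `g`
(from `G' = 2G`: the function `e^{-2s} G(s)` has zero derivative). [folklore] -/
theorem integral_inner_self_mul_comp_exp_smul_eq (hV : LocallyIntegrable V)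
    (hdiv : IsWeaklyDivFree V)
    (hrad : ∀ᵐ y ∂(volume : Measure (EuclideanSpace ℝ (Fin 3))), (‖y‖ ^ 2) • V y = ⟪V y, y⟫ • y)
    {g : (EuclideanSpace ℝ (Fin 3)) → ℝ} (hg : ContDiff ℝ ∞ g) (hgc : HasCompactSupport g) (s : ℝ) :
    (∫ y, ⟪V y, y⟫ * g (Real.exp (-s) • y)) = Real.exp (2 * s) * ∫ y, ⟪V y, y⟫ * g y := by
  set G : ℝ → ℝ := fun s => ∫ y, ⟪V y, y⟫ * g (Real.exp (-s) • y) with hG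
  have hGd : ∀ s, HasDerivAt G (2 * G s) s := fun s =>
    hasDerivAt_integral_inner_self_mul_comp_exp_smul_two_mul hV hdiv hrad hg hgc s
  have hHd : ∀ s, HasDerivAt (fun s : ℝ => Real.exp (-2 * s) * G s) 0 s := by
    intro s
    have h1 : HasDerivAt (fun s : ℝ => Real.exp (-2 * s)) (Real.exp (-2 * s) * -2) s := by
      have h := ((hasDerivAt_id s).const_mul (-2 : ℝ)).exp
      simpa using h
    refine (h1.mul (hGd s)).congr_deriv ?_
    ring
  have hHconst := is_const_of_deriv_eq_zero (f := fun s : ℝ => Real.exp (-2 * s) * G s)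
    (fun s => (hHd s).differentiableAt) fun s => (hHd s).deriv
  have hH0 : Real.exp (-2 * s) * G s = Real.exp (-2 * 0) * G 0 := hHconst s 0
  rw [mul_zero, Real.exp_zero, one_mul] at hH0
  have hG0 : G 0 = ∫ y, ⟪V y, y⟫ * g y := by
    simp only [hG, neg_zero, Real.exp_zero, one_smul]
  have hexp : Real.exp (2 * s) * Real.exp (-2 * s) = 1 := by
    rw [← Real.exp_add]; simp
  calc (∫ y, ⟪V y, y⟫ * g (Real.exp (-s) • y)) = G s := rfl
    _ = Real.exp (2 * s) * (Real.exp (-2 * s) * G s) := by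
        rw [← mul_assoc, hexp, one_mul]
    _ = Real.exp (2 * s) * ∫ y, ⟪V y, y⟫ * g y := by rw [hH0, hG0]

/-! ### Step 3: shells and the vanishing of the pairing off the origin -/

/-- **The pairing against every smooth function supported in a shell vanishes** when moreover
`∫_{B₁} |V|² < ∞`: the dilates `∫ ⟪V, y⟫ g(bᵏ⁺¹ y) dy = b^{-2(k+1)} ∫ ⟪V, y⟫ g` live on
pairwise disjoint shells `S_k ⊆ B₁` and are bounded by `(M r₂/bᵏ⁺¹) ∫_{S_k} |V|`, whence
`∫_{S_k} |V|² ≥ β > 0` for every `k` unless the pairing is zero. [folklore] -/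
theorem integral_inner_self_mul_eq_zero (hV : LocallyIntegrable V) (hdiv : IsWeaklyDivFree V)
    (hrad : ∀ᵐ y ∂(volume : Measure (EuclideanSpace ℝ (Fin 3))), (‖y‖ ^ 2) • V y = ⟪V y, y⟫ • y)
    (h2 : IntegrableOn (fun y => ‖V y‖ ^ 2) (ball (0 : (EuclideanSpace ℝ (Fin 3))) 1))
    {g : (EuclideanSpace ℝ (Fin 3)) → ℝ} (hg : ContDiff ℝ ∞ g) (hgc : HasCompactSupport g)
    (hg0 : (0 : (EuclideanSpace ℝ (Fin 3))) ∉ tsupport g) :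
    ∫ y, ⟪V y, y⟫ * g y = 0 := by
  by_contra hne
  set I₀ : ℝ := ∫ y, ⟪V y, y⟫ * g y with hI₀
  have hI₀pos : 0 < |I₀| := abs_pos.2 hne
  -- radii `0 < r₁ ≤ |z| < r₂` on the support of `g`
  obtain ⟨r₂, hr₂pos, hr₂⟩ : ∃ r₂, 0 < r₂ ∧ tsupport g ⊆ ball (0 : (EuclideanSpace ℝ (Fin 3))) r₂ :=
    hgc.isCompact.isBounded.subset_ball_lt 0 0
  obtain ⟨r₁, hr₁pos, hr₁⟩ :
      ∃ r₁, 0 < r₁ ∧ ball (0 : (EuclideanSpace ℝ (Fin 3))) r₁ ⊆ (tsupport g)ᶜ :=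
    Metric.isOpen_iff.1 (isClosed_tsupport g).isOpen_compl 0 hg0
  have hr₁' : ∀ z ∈ tsupport g, r₁ ≤ ‖z‖ := by
    intro z hz
    by_contra hlt
    exact hr₁ (by rw [mem_ball, dist_zero_right]; exact not_le.1 hlt) hz
  -- a bound on `|g|`
  obtain ⟨M, hM⟩ := hg.continuous.bounded_above_of_compact_support hgc
  set M' : ℝ := M + 1 with hM'
  have hM'pos : 0 < M' := by
    have : 0 ≤ M := (norm_nonneg _).trans (hM 0)
    linarith
  have hM'' : ∀ x, ‖g x‖ ≤ M' := fun x => (hM x).trans (by linarith)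
  -- the base of the shells
  set b : ℝ := r₂ / r₁ + r₂ + 1 with hb
  have hb1 : 1 ≤ b := by
    have : 0 ≤ r₂ / r₁ := by positivity
    linarith
  have hbpos : 0 < b := by linarith
  have hbr : r₂ ≤ r₁ * b := by
    have h : r₁ * (r₂ / r₁) = r₂ := by field_simp
    nlinarith [mul_nonneg hr₁pos.le hr₂pos.le]
  have hbr₂ : r₂ ≤ b := by
    have : 0 ≤ r₂ / r₁ := by positivity
    linarith
  -- the unit ball volume
  set v : ℝ := (volume (ball (0 : (EuclideanSpace ℝ (Fin 3))) 1)).toReal with hv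
  have hv0 : 0 ≤ v := ENNReal.toReal_nonneg
  -- shells
  set S : ℕ → Set (EuclideanSpace ℝ (Fin 3)) :=
    fun k => (fun y : (EuclideanSpace ℝ (Fin 3)) => (b ^ (k + 1)) • y) ⁻¹' tsupport g with hS
  have hck : ∀ k : ℕ, 1 ≤ b ^ (k + 1) := fun k => one_le_pow₀ hb1
  have hckpos : ∀ k : ℕ, 0 < b ^ (k + 1) := fun k => lt_of_lt_of_le one_pos (hck k)
  have hSmeas : ∀ k, MeasurableSet (S k) := fun k =>
    ((isClosed_tsupport g).preimage (continuous_const_smul _)).measurableSet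
  have hSnorm : ∀ k, ∀ y ∈ S k, ‖y‖ < r₂ / b ^ (k + 1) := by
    intro k y hy
    have h := hr₂ hy
    rw [mem_ball, dist_zero_right, norm_smul, Real.norm_eq_abs, abs_of_pos (hckpos k)] at h
    rw [lt_div_iff₀ (hckpos k)]
    linarith
  have hSnorm' : ∀ k, ∀ y ∈ S k, r₁ / b ^ (k + 1) ≤ ‖y‖ := by
    intro k y hy
    have h := hr₁' _ hy
    rw [norm_smul, Real.norm_eq_abs, abs_of_pos (hckpos k)] at h
    rw [div_le_iff₀ (hckpos k)]
    linarith
  have hSball : ∀ k, S k ⊆ ball (0 : (EuclideanSpace ℝ (Fin 3))) 1 := by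
    intro k y hy
    rw [mem_ball, dist_zero_right]
    have h := hSnorm k y hy
    have : r₂ / b ^ (k + 1) ≤ 1 := by
      rw [div_le_one (hckpos k)]
      calc r₂ ≤ b := hbr₂
        _ = b ^ 1 := (pow_one b).symm
        _ ≤ b ^ (k + 1) := pow_le_pow_right₀ hb1 (by omega)
    linarith
  have hSdisj : Pairwise (Disjoint on S) := by
    intro i j hij
    wlog hlt : i < j generalizing i j
    · exact (this hij.symm (lt_of_le_of_ne (not_lt.1 hlt) hij.symm)).symm
    rw [Function.onFun, Set.disjoint_left]
    intro y hyi hyj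
    have h1 := hSnorm' i y hyi
    have h2 := hSnorm j y hyj
    have h3 : r₁ / b ^ (i + 1) < r₂ / b ^ (j + 1) := lt_of_le_of_lt h1 h2
    rw [div_lt_div_iff₀ (hckpos i) (hckpos j)] at h3
    have h4 : b ^ (i + 2) ≤ b ^ (j + 1) := pow_le_pow_right₀ hb1 (by omega)
    have h5 : r₁ * b ^ (i + 2) ≤ r₁ * b ^ (j + 1) := mul_le_mul_of_nonneg_left h4 hr₁pos.le
    have h6 : r₁ * b ^ (i + 2) = (r₁ * b) * b ^ (i + 1) := by ring
    have h7 : r₂ * b ^ (i + 1) ≤ (r₁ * b) * b ^ (i + 1) :=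
      mul_le_mul_of_nonneg_right hbr (hckpos i).le
    linarith
  -- integrability on shells
  have hVball : IntegrableOn V (ball (0 : (EuclideanSpace ℝ (Fin 3))) 1) :=
    (hV.integrableOn_isCompact (isCompact_closedBall (0 : (EuclideanSpace ℝ (Fin 3))) 1)).mono_set
      ball_subset_closedBall
  have hVS : ∀ k, IntegrableOn (fun y => ‖V y‖) (S k) := fun k =>
    (hVball.mono_set (hSball k)).norm
  have hV2S : ∀ k, IntegrableOn (fun y => ‖V y‖ ^ 2) (S k) := fun k => h2.mono_set (hSball k)
  have hSfin : ∀ k, volume (S k) < ⊤ := fun k =>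
    (measure_mono (hSball k)).trans_lt measure_ball_lt_top
  have hSvol : ∀ k, (volume (S k)).toReal ≤ (r₂ / b ^ (k + 1)) ^ 3 * v := by
    intro k
    have hsub : S k ⊆ ball (0 : (EuclideanSpace ℝ (Fin 3))) (r₂ / b ^ (k + 1)) := fun y hy => by
      rw [mem_ball, dist_zero_right]; exact hSnorm k y hy
    have hrpos : 0 < r₂ / b ^ (k + 1) := div_pos hr₂pos (hckpos k)
    have h := measure_mono (μ := volume) hsub
    rw [Measure.addHaar_ball_of_pos volume (0 : (EuclideanSpace ℝ (Fin 3))) hrpos,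
      finrank_euclideanSpace_fin] at h
    have h' := ENNReal.toReal_mono (ENNReal.mul_ne_top ENNReal.ofReal_ne_top
      measure_ball_lt_top.ne) h
    rwa [ENNReal.toReal_mul, ENNReal.toReal_ofReal (by positivity)] at h'
  -- the scaling law on the shells: `∫ ⟪V, y⟫ g(b^(k+1) y) = (b^(k+1))⁻² I₀`
  have hscale : ∀ k : ℕ, (∫ y, ⟪V y, y⟫ * g ((b ^ (k + 1)) • y)) = ((b ^ (k + 1))⁻¹) ^ 2 * I₀ := by
    intro k
    have h := integral_inner_self_mul_comp_exp_smul_eq hV hdiv hrad hg hgc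
      (-(((k + 1 : ℕ) : ℝ) * Real.log b))
    have he : Real.exp (-(-(((k + 1 : ℕ) : ℝ) * Real.log b))) = b ^ (k + 1) := by
      rw [neg_neg, Real.exp_nat_mul, Real.exp_log hbpos]
    have he2 : Real.exp (2 * -(((k + 1 : ℕ) : ℝ) * Real.log b)) = ((b ^ (k + 1))⁻¹) ^ 2 := by
      rw [show (2 : ℝ) * -(((k + 1 : ℕ) : ℝ) * Real.log b) =
          ((2 : ℕ) : ℝ) * -(((k + 1 : ℕ) : ℝ) * Real.log b) by norm_num,
        Real.exp_nat_mul, Real.exp_neg, Real.exp_nat_mul, Real.exp_log hbpos]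
    rw [he, he2] at h
    exact h
  -- the pairing on the `k`-th shell is small: `|∫ ⟪V, y⟫ g(c y)| ≤ (M' r₂ / c) ∫_{S k} |V|`
  have hpair : ∀ k : ℕ, |∫ y, ⟪V y, y⟫ * g ((b ^ (k + 1)) • y)| ≤
      M' * r₂ / b ^ (k + 1) * ∫ y in S k, ‖V y‖ := by
    intro k
    set c : ℝ := b ^ (k + 1) with hc
    have hcpos : 0 < c := hckpos k
    have hint : Integrable fun y : (EuclideanSpace ℝ (Fin 3)) => ⟪V y, y⟫ * g (c • y) :=
      integrable_inner_self_mul hV (hg.continuous.comp (continuous_const_smul _))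
        (hgc.comp_smul hcpos.ne')
    calc |∫ y, ⟪V y, y⟫ * g (c • y)|
        = ‖∫ y, ⟪V y, y⟫ * g (c • y)‖ := (Real.norm_eq_abs _).symm
      _ ≤ ∫ y, ‖⟪V y, y⟫ * g (c • y)‖ := norm_integral_le_integral_norm _
      _ ≤ ∫ y, (S k).indicator (fun y => M' * r₂ / c * ‖V y‖) y := by
          refine integral_mono hint.norm ?_ fun y => ?_
          · have hI : IntegrableOn (fun y => M' * r₂ / c * ‖V y‖) (S k) := (hVS k).const_mul _
            exact hI.integrable_indicator (hSmeas k)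
          · by_cases hy : y ∈ S k
            · rw [indicator_of_mem hy, norm_mul]
              have hyn := hSnorm k y hy
              calc ‖⟪V y, y⟫‖ * ‖g (c • y)‖ ≤ (‖V y‖ * ‖y‖) * M' := by
                    gcongr
                    · exact norm_inner_le_norm _ _
                    · exact hM'' _
                _ ≤ (‖V y‖ * (r₂ / c)) * M' := by gcongr
                _ = M' * r₂ / c * ‖V y‖ := by ring
            · have hg0' : g (c • y) = 0 := image_eq_zero_of_notMem_tsupport hy
              rw [indicator_of_notMem hy, hg0', mul_zero, norm_zero]
      _ = M' * r₂ / c * ∫ y in S k, ‖V y‖ := by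
          rw [integral_indicator (hSmeas k), integral_const_mul]
  -- lower bound on the shell energies
  set β : ℝ := |I₀| ^ 2 / (M' ^ 2 * r₂ ^ 5 * (v + 1)) with hβ
  have hβpos : 0 < β := by positivity
  have hshell : ∀ k : ℕ, β ≤ ∫ y in S k, ‖V y‖ ^ 2 := by
    intro k
    set c : ℝ := b ^ (k + 1) with hc
    have hcpos : 0 < c := hckpos k
    have hc1 : 1 ≤ c := hck k
    set A : ℝ := ∫ y in S k, ‖V y‖ with hA
    set B : ℝ := ∫ y in S k, ‖V y‖ ^ 2 with hB
    have hA0 : 0 ≤ A := setIntegral_nonneg (hSmeas k) fun y _ => norm_nonneg _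
    -- `|I₀| ≤ c M' r₂ A`
    have h1 : |I₀| ≤ c * (M' * r₂) * A := by
      have h := hpair k
      rw [hscale k, abs_mul, abs_of_pos (by positivity : (0 : ℝ) < (c⁻¹) ^ 2)] at h
      have h' : (c⁻¹) ^ 2 * |I₀| * c ^ 2 ≤ M' * r₂ / c * A * c ^ 2 :=
        mul_le_mul_of_nonneg_right h (by positivity)
      have e1 : (c⁻¹) ^ 2 * |I₀| * c ^ 2 = |I₀| := by field_simp
      have e2 : M' * r₂ / c * A * c ^ 2 = c * (M' * r₂) * A := by field_simp
      rw [e1, e2] at h'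
      exact h'
    -- AM–GM on the shell: `2 t A ≤ t² vol(S k) + B`
    have h2t : ∀ t : ℝ, 0 < t → 2 * t * A ≤ t ^ 2 * ((r₂ / c) ^ 3 * v) + B := by
      intro t ht
      have hmono : ∫ y in S k, 2 * t * ‖V y‖ ≤ ∫ y in S k, (t ^ 2 + ‖V y‖ ^ 2) := by
        refine setIntegral_mono_on ((hVS k).const_mul (2 * t))
          ((integrableOn_const (C := t ^ 2) (hSfin k).ne).add (hV2S k)) (hSmeas k) fun y _ => ?_
        exact two_mul_le_add_sq t ‖V y‖
      rw [integral_const_mul, integral_add (integrableOn_const (C := t ^ 2) (hSfin k).ne) (hV2S k),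
        setIntegral_const, smul_eq_mul] at hmono
      have hmono' : 2 * t * A ≤ volume.real (S k) * t ^ 2 + B := hmono
      have hvol : volume.real (S k) ≤ (r₂ / c) ^ 3 * v := hSvol k
      have hvt : volume.real (S k) * t ^ 2 ≤ (r₂ / c) ^ 3 * v * t ^ 2 :=
        mul_le_mul_of_nonneg_right hvol (by positivity)
      linarith
    -- choose `t = |I₀| c² / (M' r₂⁴ (v + 1))`
    have hv1 : 0 < v + 1 := by linarith
    set t : ℝ := |I₀| * c ^ 2 / (M' * r₂ ^ 4 * (v + 1)) with ht
    have htpos : 0 < t := by positivity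
    have h3 := h2t t htpos
    -- from `h1`: `2 t |I₀| / (c M' r₂) ≤ 2 t A`
    have h4 : 2 * t * (|I₀| / (c * (M' * r₂))) ≤ 2 * t * A := by
      have : |I₀| / (c * (M' * r₂)) ≤ A := by
        rw [div_le_iff₀ (by positivity)]
        linarith
      exact mul_le_mul_of_nonneg_left this (by positivity)
    have e3 : 2 * t * (|I₀| / (c * (M' * r₂))) =
        2 * (|I₀| ^ 2 * c / (M' ^ 2 * r₂ ^ 5 * (v + 1))) := by
      rw [ht]; field_simp
    have e4 : t ^ 2 * ((r₂ / c) ^ 3 * v) ≤ |I₀| ^ 2 * c / (M' ^ 2 * r₂ ^ 5 * (v + 1)) := by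
      have e5 : t ^ 2 * ((r₂ / c) ^ 3 * (v + 1)) = |I₀| ^ 2 * c / (M' ^ 2 * r₂ ^ 5 * (v + 1)) := by
        rw [ht]; field_simp
      calc t ^ 2 * ((r₂ / c) ^ 3 * v) ≤ t ^ 2 * ((r₂ / c) ^ 3 * (v + 1)) := by
            gcongr; linarith
        _ = _ := e5
    have h5 : |I₀| ^ 2 * c / (M' ^ 2 * r₂ ^ 5 * (v + 1)) ≤ B := by linarith
    calc β = |I₀| ^ 2 * 1 / (M' ^ 2 * r₂ ^ 5 * (v + 1)) := by rw [hβ, mul_one]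
      _ ≤ |I₀| ^ 2 * c / (M' ^ 2 * r₂ ^ 5 * (v + 1)) := by gcongr
      _ ≤ B := h5
  -- summing over `N` shells contradicts `∫_{B₁} |V|² < ∞`
  set I₁ : ℝ := ∫ y in ball (0 : (EuclideanSpace ℝ (Fin 3))) 1, ‖V y‖ ^ 2 with hI₁
  obtain ⟨N, hN⟩ := exists_nat_gt (I₁ / β)
  have hsum : (N : ℝ) * β ≤ I₁ := by
    have h1 : ∑ k ∈ Finset.range N, (∫ y in S k, ‖V y‖ ^ 2) =
        ∫ y in ⋃ k ∈ Finset.range N, S k, ‖V y‖ ^ 2 :=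
      (integral_biUnion_finset (Finset.range N) (fun k _ => hSmeas k)
        (fun i _ j _ hij => hSdisj hij) (fun k _ => hV2S k)).symm
    have h2' : (∫ y in ⋃ k ∈ Finset.range N, S k, ‖V y‖ ^ 2) ≤ I₁ := by
      refine setIntegral_mono_set h2 (Eventually.of_forall fun y => by positivity) ?_
      exact (iUnion₂_subset fun k _ => hSball k).eventuallyLE
    have h3 : (N : ℝ) * β ≤ ∑ k ∈ Finset.range N, (∫ y in S k, ‖V y‖ ^ 2) := by
      have h := Finset.sum_le_sum fun k (_ : k ∈ Finset.range N) => hshell k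
      simpa using h
    linarith
  have : I₁ / β < I₁ / β := by
    calc I₁ / β < N := hN
      _ ≤ I₁ / β := by rwa [le_div_iff₀ hβpos]
  exact lt_irrefl _ this

/-! ### The theorem -/

/-- **A radial, weakly divergence-free, locally integrable field with `∫_{B₁} |V|² < ∞`
vanishes a.e.** Radiality is `|y|² V(y) = ⟪V(y), y⟫ y` a.e. (the tangential part about the
origin vanishes); the divergence condition is the tree's `IsWeakly­DivFree`
(`∫ ⟪V, ∇θ⟫ = 0` for every test function `θ`). The kinematic step of the case "`p ≥ -g`" of
the reconstruction of Seregin–Šverák 2002 (see the module docstring). [folklore] -/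
theorem ae_eq_zero_of_isWeaklyDivFree_of_radial (hV : LocallyIntegrable V)
    (hdiv : IsWeaklyDivFree V)
    (hrad : ∀ᵐ y ∂(volume : Measure (EuclideanSpace ℝ (Fin 3))), (‖y‖ ^ 2) • V y = ⟪V y, y⟫ • y)
    (h2 : IntegrableOn (fun y => ‖V y‖ ^ 2) (ball (0 : (EuclideanSpace ℝ (Fin 3))) 1)) :
    V =ᵐ[volume] 0 := by
  have hT : ∀ᵐ y ∂(volume : Measure (EuclideanSpace ℝ (Fin 3))),
      y ∈ ({0}ᶜ : Set (EuclideanSpace ℝ (Fin 3))) → ⟪V y, y⟫ = 0 := by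
    refine (isOpen_compl_singleton).ae_eq_zero_of_integral_contDiff_smul_eq_zero
      ((locallyIntegrable_inner_self hV).locallyIntegrableOn _) (fun g hg hgc hgs => ?_)
    have h0 : (0 : (EuclideanSpace ℝ (Fin 3))) ∉ tsupport g := fun h => (hgs h) rfl
    have h := integral_inner_self_mul_eq_zero hV hdiv hrad h2 hg hgc h0
    rw [← h]
    refine integral_congr_ae (Eventually.of_forall fun y => ?_)
    simp [smul_eq_mul, mul_comm]
  have hne : ∀ᵐ y ∂(volume : Measure (EuclideanSpace ℝ (Fin 3))), y ≠ 0 := by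
    have : (volume : Measure (EuclideanSpace ℝ (Fin 3))) {(0 : (EuclideanSpace ℝ (Fin 3)))} = 0 :=
      measure_singleton 0
    rw [ae_iff]
    simp only [ne_eq, not_not, setOf_eq_eq_singleton]
    exact this
  filter_upwards [hT, hrad, hne] with y hy hr hy0
  have hT0 : ⟪V y, y⟫ = 0 := hy hy0
  rw [hT0, zero_smul] at hr
  have hn : (‖y‖ ^ 2 : ℝ) ≠ 0 := pow_ne_zero _ (norm_ne_zero_iff.2 hy0)
  exact (smul_eq_zero.1 hr).resolve_left hn

end SereginSverak2002

end Literature.Analysis.FluidPDE
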